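import Summits.SmoothPoincare4.SmoothPoincare4.Theorems.ConvexBisectionAcyclicBisectionExistsChartedChainCycle
import Summits.SmoothPoincare4.SmoothPoincare4.Theorems.ConvexBisectionAcyclicBisectionExistsChartedChainSheets
import Summits.SmoothPoincare4.SmoothPoincare4.Theorems.ConvexBisectionAcyclicBisectionExistsChartedChainChordSign
import HarnessLib

/-!
# The passage loop: a page loop in the class of the next vanishing cycle that crosses the
# perpendicular bisector of the symmetric chord
(wave 4, brick Y4-4a of the model chain (R2) `exists_charted_chain` for the missing lemma
`crossingNumber_eq_stdSymp` of node N1a of stub `stub_modelsOnFibred_of_reach` = NF4, line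
`modp-braid-orbits`, crux `ConvexBisection.AcyclicBisectionExists`, item stmt-SmoothPoincare4-10508;
registered sub-goal `helper_passageLoop`)

The crossing number of the annulus chart `cycleChart` (over the symmetric chord `[η̄, η]`,
`η = ζ_0`) with the NEXT vanishing cycle (over `[ζ_0, ζ_1]`) only depends on the homology class of
the latter in the page, so we may compute it on a convenient representative: the sheet loop
(`…ChartedChainSheets.lean`) over the `x`-path `gam g` from `η` to `ζ_1` inside the closed unit disc

  `η →` (down the half-chord, `jX (e^{2πiv})`, `v ∈ [0, 1/4]`) `→ m →` (along the REAL axis,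
  `jX (iρ')`, `ρ'` from `1` to `radP (3/4)` then `radP r`, `r` from `3/4` down to `−3/4`)
  `→ x₁ = jX (i radP (−3/4)) →` (straight) `→ ζ_1`,

out on the upper sheet, back on the lower sheet (`passX`, double speed).  On the way back, over
the real segment, the loop IS the radial line `u = 1/4` of the chart traversed from height `−3/4`
to height `3/4` (`jY (iρ) = −√(jX(iρ)^{2g+1} + 1)`, `jY_I_mul_eq_neg_csqrt`: on the imaginary axis
of the `t`-plane everything is real, the Joukowski sheet is the LOWER one) — one clean climbing
passage; everywhere else it is off the collar (the sequel).  Here: the `x`-path, its continuity and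
bounds, the resulting page loop `K` (`helper_passageLoop`) and its shadow **`chainVec g 0`** (a sheet
family straightening `gam g` to the chord `[ζ_0, ζ_1]` and shrinking the page scale).
Everything is proved; no `sorry`.  References: J. Milnor, *Singular points of complex
hypersurfaces* (1968), §9 [Milnor1968]; A. Hatcher, *Algebraic Topology* (2002), Thm. 2A.1
[HatcherAT2002].
-/

noncomputable section

set_option linter.dupNamespace false

open scoped Manifold ContDiff Topology ComplexConjugate Real
open Set Function Metric Complex
open Literature.Topology.FourManifolds Literature.Topology.FourManifolds.LefschetzBase

namespace Summit.SmoothPoincare4.SmoothPoincare4.Theorems.AcyclicBisectionExists.ModpBraidOrbits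

variable {g : ℕ} {c : ℂ}

/-! ## §1 The `x`-path of the passage loop -/

/-- The radius along the approach segment: `1 → radP g (3/4)` as `v` runs over `[1/4, 1/2]`.
[folklore] -/
def rhoB (g : ℕ) (v : ℝ) : ℝ := 1 + (4 * v - 1) * (radP g (3 / 4) - 1)

/-- **The `x`-path `gam g : [0, 1] → closed unit disc`** from `η` to `ζ_1`: half-chord, real segment
(two pieces, the second parametrised by the height `r = 15/4 − 6v` of the chart), straight segment.
[folklore] -/
def gam (g : ℕ) (v : ℝ) : ℂ :=
  if v ≤ 1 / 4 then jX g (Complex.exp (((2 * π * v : ℝ) : ℂ) * I))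
  else if v ≤ 1 / 2 then jX g (I * rhoB g v)
  else if v ≤ 3 / 4 then jX g (I * radP g (15 / 4 - 6 * v))
  else jX g (I * radP g (-(3 / 4))) +
    ((4 * v - 3 : ℝ) : ℂ) * (branchPt g 1 - jX g (I * radP g (-(3 / 4))))

/-- **The `x`-coordinate of the passage loop**: out along `gam` on `[0, 1/2]`, back on `[1/2, 1]`.
[folklore] -/
def passX (g : ℕ) (τ : ℝ) : ℂ := if τ ≤ 1 / 2 then gam g (2 * τ) else gam g (2 - 2 * τ)

/-- `rhoB` runs over `[1, radP (3/4)]` on `[1/4, 1/2]`. [folklore] -/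
theorem rhoB_mem (g : ℕ) {v : ℝ} (hv : v ∈ Icc (1 / 4 : ℝ) (1 / 2)) : 1 ≤ rhoB g v ∧ rhoB g v ≤ radP g (3 / 4) := by
  have h := one_lt_radP g (3 / 4)
  unfold rhoB
  constructor <;> nlinarith [hv.1, hv.2]

/-- The pieces of `gam` on the four quarters. [folklore] -/
theorem gam_pieces (g : ℕ) (v : ℝ) :
    (v ∈ Icc (0 : ℝ) (1 / 4) → gam g v = jX g (Complex.exp (((2 * π * v : ℝ) : ℂ) * I))) ∧
    (v ∈ Icc (1 / 4 : ℝ) (1 / 2) → gam g v = jX g (I * rhoB g v)) ∧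
    (v ∈ Icc (1 / 2 : ℝ) (3 / 4) → gam g v = jX g (I * radP g (15 / 4 - 6 * v))) ∧
    (v ∈ Icc (3 / 4 : ℝ) 1 → gam g v = jX g (I * radP g (-(3 / 4))) +
      ((4 * v - 3 : ℝ) : ℂ) * (branchPt g 1 - jX g (I * radP g (-(3 / 4))))) := by
  refine ⟨fun hv => by rw [gam, if_pos hv.2], fun hv => ?_, fun hv => ?_, fun hv => ?_⟩
  · rcases eq_or_lt_of_le hv.1 with h | h
    · rw [← h, gam, if_pos le_rfl, rhoB]
      have e1 : (((2 * π * (1 / 4 : ℝ) : ℝ)) : ℂ) * I = π / 2 * I := by push_cast; ring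
      have e2 : ((1 + (4 * (1 / 4 : ℝ) - 1) * (radP g (3 / 4) - 1) : ℝ) : ℂ) = 1 := by push_cast; ring
      rw [e1, Complex.exp_pi_div_two_mul_I, e2, mul_one]
    · rw [gam, if_neg (not_le.2 h), if_pos hv.2]
  · rcases eq_or_lt_of_le hv.1 with h | h
    · rw [← h, gam, if_neg (by norm_num), if_pos le_rfl, rhoB]; norm_num
    · rw [gam, if_neg (by linarith), if_neg (not_le.2 h), if_pos hv.2]
  · rcases eq_or_lt_of_le hv.1 with h | h
    · rw [← h, gam, if_neg (by norm_num), if_neg (by norm_num), if_pos le_rfl]; norm_num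
    · rw [gam, if_neg (by linarith), if_neg (by linarith), if_neg (not_le.2 h)]

/-- End points of `gam`: `gam 0 = η = ζ_0`, `gam 1 = ζ_1`. [folklore] -/
theorem gam_ends (g : ℕ) : gam g 0 = branchPt g 0 ∧ gam g 1 = branchPt g 1 := by
  obtain ⟨hA, -, -, hD⟩ := gam_pieces g 0
  obtain ⟨-, -, -, hD1⟩ := gam_pieces g 1
  refine ⟨?_, ?_⟩
  · rw [hA ⟨le_rfl, by norm_num⟩, ← (jX_exp_pi_and_zero' g)]
    simp
  · rw [hD1 ⟨by norm_num, le_rfl⟩]; push_cast; ring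
  where
  /-- `jX (e^{0}) = ζ_0`. [folklore] -/
  jX_exp_pi_and_zero' (g : ℕ) : jX g (Complex.exp ((0 : ℝ) * I)) = branchPt g 0 := by
    rw [jX_exp, Real.cos_zero, mul_one, branchPt_zero_eq]

/-- **`gam` is continuous on `[0, 1]`** (four continuous pieces agreeing at the joints). [folklore] -/
theorem continuousOn_gam (g : ℕ) : ContinuousOn (gam g) (Icc (0 : ℝ) 1) := by
  have hjXc : ∀ {f : ℝ → ℂ} {S : Set ℝ}, ContinuousOn f S → (∀ v ∈ S, f v ≠ 0) →
      ContinuousOn (fun v => jX g (f v)) S := fun hf h0 v hv =>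
    (continuousAt_jX g (h0 v hv)).comp_continuousWithinAt (hf v hv)
  have hIne : ∀ ρ : ℝ, 0 < ρ → I * (ρ : ℂ) ≠ 0 := fun ρ hρ =>
    mul_ne_zero I_ne_zero (by exact_mod_cast hρ.ne')
  have hA : ContinuousOn (fun v : ℝ => jX g (Complex.exp (((2 * π * v : ℝ) : ℂ) * I))) (Icc (0 : ℝ) (1 / 4)) :=
    hjXc (Continuous.continuousOn (by fun_prop)) fun v _ => Complex.exp_ne_zero _
  have hB : ContinuousOn (fun v : ℝ => jX g (I * rhoB g v)) (Icc (1 / 4 : ℝ) (1 / 2)) :=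
    hjXc (Continuous.continuousOn (by unfold rhoB; fun_prop)) fun v hv => hIne _ (by linarith [(rhoB_mem g hv).1])
  have hC : ContinuousOn (fun v : ℝ => jX g (I * radP g (15 / 4 - 6 * v))) (Icc (1 / 2 : ℝ) (3 / 4)) :=
    hjXc (Continuous.continuousOn (by have := contDiff_radP g; fun_prop)) fun v _ => hIne _ (radP_pos g _)
  have hD : ContinuousOn (fun v : ℝ => jX g (I * radP g (-(3 / 4))) +
      ((4 * v - 3 : ℝ) : ℂ) * (branchPt g 1 - jX g (I * radP g (-(3 / 4))))) (Icc (3 / 4 : ℝ) 1) :=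
    Continuous.continuousOn (by fun_prop)
  have e : Icc (0 : ℝ) 1 = ((Icc (0 : ℝ) (1 / 4) ∪ Icc (1 / 4) (1 / 2)) ∪ Icc (1 / 2) (3 / 4)) ∪ Icc (3 / 4) 1 := by
    rw [Icc_union_Icc_eq_Icc (by norm_num) (by norm_num), Icc_union_Icc_eq_Icc (by norm_num) (by norm_num),
      Icc_union_Icc_eq_Icc (by norm_num) (by norm_num)]
  rw [e]
  refine ContinuousOn.union_of_isClosed (ContinuousOn.union_of_isClosed (ContinuousOn.union_of_isClosed
    (hA.congr fun v hv => (gam_pieces g v).1 hv) (hB.congr fun v hv => (gam_pieces g v).2.1 hv) isClosed_Icc isClosed_Icc)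
    (hC.congr fun v hv => (gam_pieces g v).2.2.1 hv) (isClosed_Icc.union isClosed_Icc) isClosed_Icc)
    (hD.congr fun v hv => (gam_pieces g v).2.2.2 hv) ((isClosed_Icc.union isClosed_Icc).union isClosed_Icc) isClosed_Icc

/-- **`gam` stays in the closed unit disc** (`g ≥ 1`). [folklore] -/
theorem norm_gam_le (hg : 1 ≤ g) {v : ℝ} (hv : v ∈ Icc (0 : ℝ) 1) : ‖gam g v‖ ≤ 1 := by
  obtain ⟨hA, hB, hC, hD⟩ := gam_pieces g v
  have hR : ∀ r : ℝ, ‖jX g (I * radP g r)‖ ≤ 1 := fun r =>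
    norm_jX_I_mul_le hg (one_lt_radP g r).le (radP_le_thirteen_twelfths hg r)
  by_cases h1 : v ≤ 1 / 4
  · rw [hA ⟨hv.1, h1⟩]; exact norm_jX_exp_le g _
  by_cases h2 : v ≤ 1 / 2
  · have hv' : v ∈ Icc (1 / 4 : ℝ) (1 / 2) := ⟨(not_le.1 h1).le, h2⟩
    rw [hB hv']
    exact norm_jX_I_mul_le hg (rhoB_mem g hv').1 ((rhoB_mem g hv').2.trans (radP_le_thirteen_twelfths hg _))
  by_cases h3 : v ≤ 3 / 4
  · rw [hC ⟨(not_le.1 h2).le, h3⟩]; exact hR _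
  · rw [hD ⟨(not_le.1 h3).le, hv.2⟩]
    have hl : (0 : ℝ) ≤ 4 * v - 3 := by linarith [not_le.1 h3]
    have hl1 : 4 * v - 3 ≤ (1 : ℝ) := by linarith [hv.2]
    calc ‖jX g (I * radP g (-(3 / 4))) + ((4 * v - 3 : ℝ) : ℂ) * (branchPt g 1 - jX g (I * radP g (-(3 / 4))))‖
        = ‖((1 - (4 * v - 3) : ℝ) : ℂ) * jX g (I * radP g (-(3 / 4))) + ((4 * v - 3 : ℝ) : ℂ) * branchPt g 1‖ := by
          congr 1; push_cast; ring
      _ ≤ (1 - (4 * v - 3)) * 1 + (4 * v - 3) * 1 := by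
          refine (norm_add_le _ _).trans ?_
          rw [norm_mul, norm_mul, Complex.norm_real, Complex.norm_real, Real.norm_eq_abs, Real.norm_eq_abs,
            abs_of_nonneg (by linarith), abs_of_nonneg hl, norm_branchPt]
          have := mul_le_mul_of_nonneg_left (hR (-(3 / 4))) (by linarith : (0 : ℝ) ≤ 1 - (4 * v - 3))
          linarith
      _ = 1 := by ring

/-- The pieces of `passX`. [folklore] -/
theorem passX_pieces (g : ℕ) (τ : ℝ) :
    (τ ∈ Icc (0 : ℝ) (1 / 2) → passX g τ = gam g (2 * τ)) ∧ (τ ∈ Icc (1 / 2 : ℝ) 1 → passX g τ = gam g (2 - 2 * τ)) := by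
  refine ⟨fun h => by rw [passX, if_pos h.2], fun h => ?_⟩
  rcases eq_or_lt_of_le h.1 with e | e
  · rw [← e, passX, if_pos le_rfl]; norm_num
  · rw [passX, if_neg (not_le.2 e)]

/-- **`passX` is continuous on `[0, 1]`, in the closed unit disc, closed, through `ζ_0` at `0` and
`ζ_1` at `1/2`.** [folklore] -/
theorem passX_props (hg : 1 ≤ g) :
    ContinuousOn (passX g) (Icc (0 : ℝ) 1) ∧ (∀ τ ∈ Icc (0 : ℝ) 1, ‖passX g τ‖ ≤ 1) ∧
      passX g 0 = branchPt g 0 ∧ passX g 1 = branchPt g 0 ∧ passX g (1 / 2) = branchPt g 1 := by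
  obtain ⟨h0, h1⟩ := gam_ends g
  refine ⟨?_, fun τ hτ => ?_, ?_, ?_, ?_⟩
  · rw [← Icc_union_Icc_eq_Icc (show (0 : ℝ) ≤ 1 / 2 by norm_num) (show (1 / 2 : ℝ) ≤ 1 by norm_num)]
    refine ContinuousOn.union_of_isClosed ?_ ?_ isClosed_Icc isClosed_Icc
    · refine (((continuousOn_gam g).comp (Continuous.continuousOn (by fun_prop)) fun τ hτ =>
        ⟨by linarith [hτ.1], by linarith [hτ.2]⟩).congr fun τ hτ => (passX_pieces g τ).1 hτ)
    · refine (((continuousOn_gam g).comp (Continuous.continuousOn (by fun_prop)) fun τ hτ =>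
        ⟨by linarith [hτ.2], by linarith [hτ.1]⟩).congr fun τ hτ => (passX_pieces g τ).2 hτ)
  · by_cases h : τ ≤ 1 / 2
    · rw [(passX_pieces g τ).1 ⟨hτ.1, h⟩]; exact norm_gam_le hg ⟨by linarith [hτ.1], by linarith⟩
    · rw [(passX_pieces g τ).2 ⟨(not_le.1 h).le, hτ.2⟩]
      exact norm_gam_le hg ⟨by linarith [hτ.2], by linarith [not_le.1 h]⟩
  · rw [(passX_pieces g 0).1 ⟨le_rfl, by norm_num⟩, mul_zero, h0]
  · rw [(passX_pieces g 1).2 ⟨by norm_num, le_rfl⟩]; norm_num; exact h0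
  · rw [(passX_pieces g (1 / 2)).1 ⟨by norm_num, le_rfl⟩]; norm_num; exact h1

/-! ## §2 The passage loop and its shadow -/

/-- **Sub-goal `helper_passageLoop`** (Y4-4a of the model chain (R2) for node N1a of NF4): for
`g ≥ 1` and `‖c‖ ≤ 1` there is a continuous page loop `K : 𝕊¹ → page g c` tracing on `[0, 1]` the
sheet loop over `passX g`, with homology shadow `chainVec g 0` (a sheet family to the `0`-th chain
loop). [cite: Milnor1968, Thm. 9.1] -/
theorem helper_passageLoop : ∀ (g : ℕ) (c : ℂ) (_hg : 1 ≤ g) (_hc : ‖c‖ ≤ 1), ∃ (K : Metric.sphere (0 : EuclideanSpace ℝ (Fin 2)) 1 → Literature.Topology.FourManifolds.LefschetzBase.Base g) (hK : Continuous K), (∀ θ, K θ ∈ Literature.Topology.FourManifolds.LefschetzBase.page g c) ∧ (∀ τ ∈ Set.Icc (0 : ℝ) 1, (K (Literature.Topology.FourManifolds.circlePt τ)).1 = Summit.SmoothPoincare4.SmoothPoincare4.Theorems.AcyclicBisectionExists.ModpBraidOrbits.sheetAmb g c τ (Summit.SmoothPoincare4.SmoothPoincare4.Theorems.AcyclicBisectionExists.ModpBraidOrbits.passX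 g τ)) ∧ Literature.Topology.FourManifolds.LefschetzBase.shadow g K hK = Literature.Topology.FourManifolds.LefschetzBase.chainVec g 0 := by
  intro g c hg hc
  obtain ⟨hXc, hX1, hX0, hX1', hXh⟩ := passX_props (g := g) hg
  have hb0 : passX g 0 ^ (2 * g + 1) + 1 = 0 := by rw [hX0, branchPt_pow, neg_add_cancel]
  have hbh : passX g (1 / 2) ^ (2 * g + 1) + 1 = 0 := by rw [hXh, branchPt_pow, neg_add_cancel]
  obtain ⟨K, hK, hKτ, hKp⟩ := exists_sheetCircle hc (passX g) hXc hX1 (hX0.trans hX1'.symm) hb0 hbh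
  obtain ⟨K₂, hK₂, hK₂u⟩ := exists_chainCircle g 0
  refine ⟨K, hK, hKp, hKτ, ?_⟩
  have hg2 : 0 < 2 * g := by omega
  rw [← helper_shadow_sheetLoop_chain g 0 hg2 K₂ hK₂ hK₂u]
  symm
  obtain ⟨hz0, hz1, hzh⟩ := chordZig_ends g 0
  refine shadow_eq_of_sheet_family hc (fun s => s) continuousOn_id (fun s hs => by rw [abs_of_nonneg hs.1]; exact hs.2)
    (fun s τ => ((1 - s : ℝ) : ℂ) * chordZig g 0 τ + (s : ℂ) * passX g τ) ?_ ?_ ?_ ?_ ?_ hK₂ hK ?_ ?_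
  · have h1 : ContinuousOn (fun p : ℝ × ℝ => passX g p.2) (Icc (0 : ℝ) 1 ×ˢ Icc (0 : ℝ) 1) :=
      hXc.comp continuousOn_snd fun p hp => hp.2
    have h2 : Continuous fun p : ℝ × ℝ => chordZig g 0 p.2 := (continuous_chordZig g 0).comp continuous_snd
    exact ((Complex.continuous_ofReal.comp (continuous_const.sub continuous_fst)).continuousOn.mul h2.continuousOn).add
      ((Complex.continuous_ofReal.comp continuous_fst).continuousOn.mul h1)
  · intro s hs τ hτ
    calc ‖((1 - s : ℝ) : ℂ) * chordZig g 0 τ + (s : ℂ) * passX g τ‖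
        ≤ ‖((1 - s : ℝ) : ℂ) * chordZig g 0 τ‖ + ‖(s : ℂ) * passX g τ‖ := norm_add_le _ _
      _ ≤ (1 - s) * 1 + s * 1 := by
          rw [norm_mul, norm_mul, Complex.norm_real, Complex.norm_real, Real.norm_eq_abs, Real.norm_eq_abs,
            abs_of_nonneg (by linarith [hs.2]), abs_of_nonneg hs.1]
          have e1 := mul_le_mul_of_nonneg_left (norm_chordZig_le g 0 hτ) (by linarith [hs.2] : (0 : ℝ) ≤ 1 - s)
          have e2 := mul_le_mul_of_nonneg_left (hX1 τ hτ) hs.1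
          linarith
      _ = 1 := by ring
  · intro s _; rw [hz0, hz1, hX0, hX1']
  · intro s _
    rw [hz0, hX0, show ((1 - s : ℝ) : ℂ) * branchPt g 0 + (s : ℂ) * branchPt g 0 = branchPt g 0 by push_cast; ring,
      branchPt_pow, neg_add_cancel]
  · intro s _
    rw [hzh, hXh, show ((1 - s : ℝ) : ℂ) * branchPt g (0 + 1) + (s : ℂ) * branchPt g 1 = branchPt g 1 by
      push_cast; ring, branchPt_pow, neg_add_cancel]
  · intro τ hτ; rw [hK₂u τ hτ]; simp
  · intro τ hτ; rw [hKτ τ hτ]; simp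

end Summit.SmoothPoincare4.SmoothPoincare4.Theorems.AcyclicBisectionExists.ModpBraidOrbits

end
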